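import Summits.HubbardSuperconductivity.HubbardSuperconductivity.Theorems.AnisotropyChordTransferFibre3C0Layer
import Summits.HubbardSuperconductivity.HubbardSuperconductivity.Theorems.AnisotropyChordTransferFibre3OneLoop

/-!
# Route `AnisotropyChord` / H0 rotor rung: `PiNormOneLoop` and `AxhatOneLoop` (PartN33 Layer B) PROVED

Memo 21 §297(A) (theory seat `hubbard-h0-rotor-theory-1`): with `g = f²`, `ĝ = FT[g]` (`dft`), the correlation identity
`Σ_b g(b)g(b−s) = (1/V)Σ_k ĝ(k) conj ĝ(k) e^{ik·s}` (`corr_fourier`, character orthogonality) and reality of `ĝ` for even `f`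
(`conj_dft_even`) give **`axhatOneLoop_holds : AxhatOneLoop L`** (`A(x̂) = (1/V)Σ_k F₂(k)² cos kₓ`) and
**`piNormOneLoop_holds : PiNormOneLoop L`** (`‖Π⁰‖² = Σ_a g(a)·corr(a) = (1/V)Σ_k F₂(k)³`).
Prover seat `hubbard-h0-rotor-p1` g22; helper for stmt-HubbardSuperconductivity-19089 (`--supports`).
-/

set_option linter.dupNamespace false
set_option autoImplicit false

noncomputable section

open scoped BigOperators
open Complex

namespace Summit.HubbardSuperconductivity.HubbardSuperconductivity.Theorems.AnisotropyChord.Transfer.Fibre3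

variable (L : ℕ) [NeZero L]

/-! ## Character bookkeeping -/

/-- `conj φ_k(r) · φ_k(r') · φ_k(s) = φ_k(r' + s − r)`. [folklore] -/
theorem conj_phase_mul_mul (k r r' s : Tor L) :
    (starRingEnd ℂ) (phase L k r) * phase L k r' * phase L k s = phase L k (r' + s - r) := by
  rw [conj_phase, sub_eq_add_neg, phase_add, phase_add]; ring

/-- **correlation in Fourier space:** `Σ_b g(b) g(b − s) = (1/V) Σ_k ĝ(k) conj ĝ(k) e^{ik·s}`. [folklore] -/
theorem corr_fourier (g : Tor L → ℝ) (s : Tor L) :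
    ((∑ b : Tor L, g b * g (b - s) : ℝ) : ℂ)
      = (∑ k : Tor L, dft L g k * (starRingEnd ℂ) (dft L g k) * phase L k s) / ((L : ℂ) ^ 2) := by
  have hV : ((L : ℂ) ^ 2) ≠ 0 := by
    have : (L : ℂ) ≠ 0 := by exact_mod_cast (NeZero.ne L)
    positivity
  rw [eq_div_iff hV]
  unfold dft
  -- expand: Σ_k (Σ_r conj φ g r)(Σ_r' φ g r') φ(s) = Σ_r Σ_r' g r g r' Σ_k φ_k(r' + s − r)
  have e1 : ∀ k : Tor L, (∑ r : Tor L, (starRingEnd ℂ) (phase L k r) * (g r : ℂ))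
        * (starRingEnd ℂ) (∑ r' : Tor L, (starRingEnd ℂ) (phase L k r') * (g r' : ℂ)) * phase L k s
      = ∑ r : Tor L, ∑ r' : Tor L, ((g r : ℂ) * (g r' : ℂ)) * phase L k (r' + s - r) := by
    intro k
    rw [map_sum]
    simp only [map_mul, Complex.conj_conj, Complex.conj_ofReal]
    rw [Finset.sum_mul_sum, Finset.sum_mul]
    refine Finset.sum_congr rfl fun r _ => ?_
    rw [Finset.sum_mul]
    refine Finset.sum_congr rfl fun r' _ => ?_
    rw [← conj_phase_mul_mul L k r r' s]; ring
  rw [Finset.sum_congr rfl fun k _ => e1 k, Finset.sum_comm]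
  simp_rw [Finset.sum_comm (γ := Tor L) (s := (Finset.univ : Finset (Tor L))) (t := (Finset.univ : Finset (Tor L)))
    (f := fun k r' => ((g _ : ℂ) * (g r' : ℂ)) * phase L k (r' + s - _))]
  -- Σ_k φ_k(r' + s − r) = V [r = r' + s]
  have e2 : ∀ r : Tor L, ∑ r' : Tor L, ∑ k : Tor L, ((g r : ℂ) * (g r' : ℂ)) * phase L k (r' + s - r)
      = (g r : ℂ) * (g (r - s) : ℂ) * (L : ℂ) ^ 2 := by
    intro r
    have : ∀ r' : Tor L, ∑ k : Tor L, ((g r : ℂ) * (g r' : ℂ)) * phase L k (r' + s - r)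
        = if r - s = r' then (g r : ℂ) * (g r' : ℂ) * (L : ℂ) ^ 2 else 0 := by
      intro r'
      rw [← Finset.mul_sum, sum_phase_left]
      have hiff : (r' + s - r = 0) ↔ (r - s = r') := by
        constructor <;> intro h
        · have := sub_eq_zero.mp h; rw [← this]; abel
        · rw [← h]; abel
      simp only [hiff]
      split_ifs <;> simp
    rw [Finset.sum_congr rfl fun r' _ => this r', Finset.sum_ite_eq Finset.univ (r - s)]
    simp
  rw [Finset.sum_congr rfl fun r _ => e2 r, ← Finset.sum_mul]
  push_cast
  rfl

/-- for an even `g`, `ĝ(k)` is real: `conj ĝ(k) = ĝ(k)`. [folklore] -/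
theorem conj_dft_even {g : Tor L → ℝ} (hev : ∀ r : Tor L, g (-r) = g r) (k : Tor L) :
    (starRingEnd ℂ) (dft L g k) = dft L g k := by
  unfold dft
  rw [map_sum]
  simp only [map_mul, Complex.conj_conj, Complex.conj_ofReal]
  rw [← Fintype.sum_equiv (Equiv.neg (Tor L)) (fun r => (starRingEnd ℂ) (phase L k r) * (g r : ℂ))
    (fun r => phase L k r * (g r : ℂ)) (fun r => by simp only [Equiv.neg_apply, ← conj_phase, hev])]
  -- (the equivalence statement above is `conj φ(r) g r = φ(−r) g(−r)`)

/-- an even `g`: `ĝ(k) = (Re ĝ(k) : ℂ)`. [folklore] -/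
theorem dft_even_eq_re {g : Tor L → ℝ} (hev : ∀ r : Tor L, g (-r) = g r) (k : Tor L) :
    dft L g k = (((dft L g k).re : ℝ) : ℂ) := by
  have h := conj_dft_even L hev k
  exact (Complex.conj_eq_iff_re.mp h).symm

/-! ## `AxhatOneLoop` -/

/-- `Re e^{ik·x̂} = cos(2π kₓ/L)`. [folklore] -/
theorem phase_ex_re (k : Tor L) : (phase L k (ex L)).re = Real.cos (2 * Real.pi * k.1.val / L) := by
  rw [phase_ex, show (2 * (Real.pi : ℂ) * Complex.I * (((k.1.val : ℕ) : ℂ) / (L : ℂ)))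
      = ((2 * Real.pi * k.1.val / L : ℝ) : ℂ) * Complex.I by push_cast; ring, Complex.exp_ofReal_mul_I_re]

/-- ★ **`AxhatOneLoop L` holds.** [folklore] -/
theorem axhatOneLoop_holds : AxhatOneLoop L := by
  intro f hev
  have hgev : ∀ r : Tor L, (fun r => f r ^ 2) (-r) = (fun r => f r ^ 2) r := by intro r; simp only [hev]
  have hc := corr_fourier L (fun r => f r ^ 2) (K1 L)
  -- make everything real
  have hk : ∀ k : Tor L, dft L (fun r => f r ^ 2) k * (starRingEnd ℂ) (dft L (fun r => f r ^ 2) k) * phase L k (K1 L)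
      = (((F2 L f k ^ 2 : ℝ)) : ℂ) * phase L k (ex L) := by
    intro k
    rw [conj_dft_even L hgev, dft_even_eq_re L hgev]
    unfold F2
    push_cast
    rw [show K1 L = ex L from rfl]
    ring
  rw [Finset.sum_congr rfl fun k _ => hk k] at hc
  unfold Axhat
  have hre := congrArg Complex.re hc
  rw [Complex.ofReal_re] at hre
  rw [show K1 L = ex L from rfl] at hre ⊢
  rw [hre]
  have hV : ((L : ℂ) ^ 2) = (((L : ℝ) ^ 2 : ℝ) : ℂ) := by push_cast; ring
  rw [hV, Complex.div_ofReal_re, Complex.re_sum]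
  congr 1
  refine Finset.sum_congr rfl fun k _ => ?_
  rw [Complex.re_ofReal_mul, phase_ex_re]

/-! ## `PiNormOneLoop` -/

/-- ★ **`PiNormOneLoop L` holds.** [folklore] -/
theorem piNormOneLoop_holds : PiNormOneLoop L := by
  intro f hev
  have hgev : ∀ r : Tor L, (fun r => f r ^ 2) (-r) = (fun r => f r ^ 2) r := by intro r; simp only [hev]
  have hV0 : ((L : ℂ) ^ 2) ≠ 0 := by
    have : (L : ℂ) ≠ 0 := by exact_mod_cast (NeZero.ne L)
    positivity
  -- ‖Π‖² = Σ_a g(a) corr(a)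
  have h1 : ((PiNormSq L f : ℝ) : ℂ) = ∑ a : Tor L, ((f a ^ 2 : ℝ) : ℂ) * ((∑ b : Tor L, f b ^ 2 * f (b - a) ^ 2 : ℝ) : ℂ) := by
    unfold PiNormSq
    rw [Fintype.sum_prod_type]
    push_cast
    refine Finset.sum_congr rfl fun a _ => ?_
    rw [Finset.mul_sum]
    refine Finset.sum_congr rfl fun b _ => ?_
    unfold piR
    simp only
    push_cast
    ring
  -- insert the Fourier form of the correlation and resum over `a`
  have h2 : ∀ a : Tor L, ((f a ^ 2 : ℝ) : ℂ) * ((∑ b : Tor L, f b ^ 2 * f (b - a) ^ 2 : ℝ) : ℂ)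
      = (∑ k : Tor L, ((F2 L f k ^ 2 : ℝ) : ℂ) * (phase L k a * ((f a ^ 2 : ℝ) : ℂ))) / ((L : ℂ) ^ 2) := by
    intro a
    have hc := corr_fourier L (fun r => f r ^ 2) a
    rw [hc, mul_div_assoc', Finset.mul_sum]
    congr 1
    refine Finset.sum_congr rfl fun k _ => ?_
    rw [conj_dft_even L hgev, dft_even_eq_re L hgev]
    unfold F2
    push_cast
    ring
  have h3 : ∑ a : Tor L, (∑ k : Tor L, ((F2 L f k ^ 2 : ℝ) : ℂ) * (phase L k a * ((f a ^ 2 : ℝ) : ℂ))) / ((L : ℂ) ^ 2)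
      = (∑ k : Tor L, ((F2 L f k ^ 2 : ℝ) : ℂ) * (starRingEnd ℂ) (dft L (fun r => f r ^ 2) k)) / ((L : ℂ) ^ 2) := by
    rw [← Finset.sum_div, Finset.sum_comm]
    congr 1
    refine Finset.sum_congr rfl fun k _ => ?_
    rw [← Finset.mul_sum]
    congr 1
    unfold dft
    rw [map_sum]
    refine Finset.sum_congr rfl fun a _ => ?_
    rw [map_mul, Complex.conj_conj, Complex.conj_ofReal]
  have h4 : ((PiNormSq L f : ℝ) : ℂ) = (((∑ k : Tor L, F2 L f k ^ 3) / (L : ℝ) ^ 2 : ℝ) : ℂ) := by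
    rw [h1, Finset.sum_congr rfl fun a _ => h2 a, h3]
    push_cast
    congr 1
    refine Finset.sum_congr rfl fun k _ => ?_
    rw [conj_dft_even L hgev, dft_even_eq_re L hgev]
    unfold F2
    ring
  exact_mod_cast h4

end Summit.HubbardSuperconductivity.HubbardSuperconductivity.Theorems.AnisotropyChord.Transfer.Fibre3

end
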